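import Mathlib
import Summits.Ventures.HSemireg.ApolarGramCirculant

/-!
# Venture HSemireg — apolar Gram matrix: the EVEN cells (THEOREM A(i) complete) and the sign law for odd `ρ`

HONEST FRAMING. Finite-dimensional real linear algebra only; no variety / sheaf / semiregularity
map; nothing here says that HC / HC_CM / HC_AV holds; no Literature fact is declared or assumed.

Fourth file of the apolar chain (`ApolarGramParity` ⟶ `ApolarGramHankel` ⟶ `ApolarGramCirculant`
⟶ this file; cell pub-hsemireg, FORMULA-N PART A §2.9 = theory/th6/apolar/APOLAR-GRAM-RANK-th6g8.md
§1 (c)(e)). For `n` EVEN and distinct increasing real atoms `x_0 < … < x_{ρ−1}`, `2 ≤ ρ ≤ n + 1`: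

* `det_gram_pos_of_pos_at` — sign constancy of `det G_n` on the CONVEX space of strictly
  increasing configurations (segment + `intermediate_value_Icc'` + `Continuous.matrix_det`).
* `det_gram_pos_odd` — `ρ` odd `≥ 3` ⇒ `det ((x_i − x_j)^n) > 0` (THEOREM A′, odd `ρ`): `det ≠ 0`
  everywhere (parity cell) + sign constancy + the cot reference configuration
  (`det_gram_cotConfig_pos` of `ApolarGramCirculant`).
* `gram_append` / `det_gram_append` — block form of `gram (Fin.append X Y)` and the Schur
  factorisation (`Matrix.det_fromBlocks₁₁`); `det_gram_ne_zero_of_between` — the 2 × 2 Schur step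
  §1 (e): positivity at the odd sizes `r` and `r + 2` forces `det ≠ 0` at the even size `r + 1`.
* **`det_gram_ne_zero_even` / `rank_gram_even`** — `n` even, `2 ≤ ρ ≤ n + 1` ⇒
  `det ((x_i − x_j)^n) ≠ 0`, `rank = ρ`: THEOREM A(i) in full.
* `rank_hsq_expMoments` — the Hankel rank of exponential data with `ρ ≤ n + 1` distinct nodes and
  non-zero weights is `ρ` (the `ρ` of the one-sided rank law IS the number of atoms), and the
  packaged dictionaries `hankel_dictionary_even` / `_odd_odd` / `_odd_even` = the two inputs
  (`ρ`, `rank(H_n Ω_n H_n)`) of p6's `weilPurity_oneSided_b_zero`, for every cell of THEOREM A.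

NOT here: the sign law at even `ρ` (`ApolarGramSign`) and the inertia law.
-/

noncomputable section

open Matrix Finset
open scoped BigOperators

namespace Summit.Ventures.HSemireg.ApolarGram


/-! ### Sign constancy of `det G_n` on the (convex) configuration space -/

/-- convex combinations of strictly increasing tuples are strictly increasing. -/
theorem strictMono_segment {ρ : ℕ} {x₀ x₁ : Fin ρ → ℝ} (h₀ : StrictMono x₀) (h₁ : StrictMono x₁)
    {s : ℝ} (hs0 : 0 ≤ s) (hs1 : s ≤ 1) : StrictMono (fun i => (1 - s) * x₀ i + s * x₁ i) := by
  intro i j hij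
  have a := h₀ hij
  have b := h₁ hij
  rcases eq_or_lt_of_le hs1 with rfl | hs1'
  · simp only [sub_self, zero_mul, zero_add, one_mul]; exact b
  · have : 0 < 1 - s := by linarith
    nlinarith

/-- the determinant along the segment is continuous. -/
theorem continuous_det_gram_segment (n : ℕ) {ρ : ℕ} (x₀ x₁ : Fin ρ → ℝ) :
    Continuous fun s : ℝ => (gram n (fun i => (1 - s) * x₀ i + s * x₁ i)).det := by
  apply Continuous.matrix_det
  apply continuous_matrix
  intro i j
  simp only [gram, Matrix.of_apply]
  fun_prop

/-- **sign constancy**: if `det G_n ≠ 0` on all strictly increasing `ρ`-configurations and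
`det G_n(x₀) > 0` for one of them, then `det G_n(x) > 0` for all of them. -/
theorem det_gram_pos_of_pos_at {n ρ : ℕ}
    (hne : ∀ x : Fin ρ → ℝ, StrictMono x → (gram n x).det ≠ 0)
    {x₀ x₁ : Fin ρ → ℝ} (h₀ : StrictMono x₀) (h₁ : StrictMono x₁) (hpos : 0 < (gram n x₀).det) :
    0 < (gram n x₁).det := by
  set f := fun s : ℝ => (gram n (fun i => (1 - s) * x₀ i + s * x₁ i)).det with hf
  have hf0 : f 0 = (gram n x₀).det := by simp [hf]
  have hf1 : f 1 = (gram n x₁).det := by simp [hf]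
  rcases lt_or_gt_of_ne (hne x₁ h₁) with hneg | hpos1
  · exfalso
    have hcont : ContinuousOn f (Set.Icc 0 1) := (continuous_det_gram_segment n x₀ x₁).continuousOn
    have hmem : (0 : ℝ) ∈ Set.Icc (f 1) (f 0) := ⟨by rw [hf1]; exact hneg.le, by rw [hf0]; exact hpos.le⟩
    obtain ⟨s, hs, hfs⟩ := intermediate_value_Icc' zero_le_one hcont hmem
    exact hne _ (strictMono_segment h₀ h₁ hs.1 hs.2) hfs
  · exact hpos1

/-! ### Bordered Gram matrices and the Schur complement -/

/-- the cross block `(X_i − Y_a)^n`. -/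
def cross (n : ℕ) {r m : ℕ} (X : Fin r → ℝ) (Y : Fin m → ℝ) : Matrix (Fin r) (Fin m) ℝ :=
  Matrix.of fun i a => (X i - Y a) ^ n

/-- block form of the Gram matrix of a concatenated configuration (`n` even). -/
theorem gram_append {n : ℕ} (hn : Even n) {r m : ℕ} (X : Fin r → ℝ) (Y : Fin m → ℝ) :
    gram n (Fin.append X Y) = Matrix.reindex finSumFinEquiv finSumFinEquiv
      (Matrix.fromBlocks (gram n X) (cross n X Y) (cross n X Y)ᵀ (gram n Y)) := by
  have hsym : ∀ u v : ℝ, (v - u) ^ n = (u - v) ^ n := fun u v => by rw [← neg_sub u v, hn.neg_pow]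
  ext i j
  rw [Matrix.reindex_apply, Matrix.submatrix_apply]
  obtain ⟨i', rfl⟩ := finSumFinEquiv.surjective i
  obtain ⟨j', rfl⟩ := finSumFinEquiv.surjective j
  rw [Equiv.symm_apply_apply, Equiv.symm_apply_apply]
  rcases i' with i' | i' <;> rcases j' with j' | j' <;>
    simp [gram, cross, Matrix.fromBlocks_apply₁₁, Matrix.fromBlocks_apply₁₂,
      Matrix.fromBlocks_apply₂₁, Matrix.fromBlocks_apply₂₂, Fin.append_left, Fin.append_right, hsym]


/-- gram matrices are symmetric for even `n`. -/
theorem gram_transpose_of_even {n : ℕ} (hn : Even n) {r : ℕ} (X : Fin r → ℝ) :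
    (gram n X)ᵀ = gram n X := by
  ext i j
  simp only [gram, Matrix.transpose_apply, Matrix.of_apply]
  rw [← neg_sub (X i) (X j), hn.neg_pow]

/-- **Schur factorisation** of the determinant of a concatenated configuration. -/
theorem det_gram_append {n : ℕ} (hn : Even n) {r m : ℕ} (X : Fin r → ℝ) (Y : Fin m → ℝ)
    [Invertible (gram n X)] :
    (gram n (Fin.append X Y)).det =
      (gram n X).det * (gram n Y - (cross n X Y)ᵀ * ⅟(gram n X) * cross n X Y).det := by
  rw [gram_append hn, Matrix.det_reindex_self, Matrix.det_fromBlocks₁₁]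

/-- the Schur complement `E = G_Y − Cᵀ A⁻¹ C` is symmetric (`n` even). -/
theorem schur_transpose {n : ℕ} (hn : Even n) {r m : ℕ} (X : Fin r → ℝ) (Y : Fin m → ℝ)
    [Invertible (gram n X)] :
    (gram n Y - (cross n X Y)ᵀ * ⅟(gram n X) * cross n X Y)ᵀ =
      gram n Y - (cross n X Y)ᵀ * ⅟(gram n X) * cross n X Y := by
  have hAt : (⅟(gram n X))ᵀ = ⅟(gram n X) := by
    rw [Matrix.invOf_eq_nonsing_inv, Matrix.transpose_nonsing_inv, gram_transpose_of_even hn]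
  rw [Matrix.transpose_sub, gram_transpose_of_even hn, Matrix.transpose_mul, Matrix.transpose_mul,
    Matrix.transpose_transpose, hAt, Matrix.mul_assoc]

/-- the `(0,0)` entries of the one-point and the two-point Schur complements agree. -/
theorem schur_two_zero_zero {n : ℕ} {r : ℕ} (X : Fin r → ℝ) (y₁ y₂ : ℝ) [Invertible (gram n X)] :
    (gram n ![y₁, y₂] - (cross n X ![y₁, y₂])ᵀ * ⅟(gram n X) * cross n X ![y₁, y₂]) 0 0 =
      (gram n ![y₁] - (cross n X ![y₁])ᵀ * ⅟(gram n X) * cross n X ![y₁]) 0 0 := by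
  simp [gram, cross, Matrix.mul_apply, Matrix.transpose_apply]

/-- strictly increasing concatenation. -/
theorem strictMono_append {r m : ℕ} {X : Fin r → ℝ} {Y : Fin m → ℝ} (hX : StrictMono X)
    (hY : StrictMono Y) (hXY : ∀ i a, X i < Y a) : StrictMono (Fin.append X Y) := by
  intro p q hpq
  obtain ⟨p', rfl⟩ := finSumFinEquiv.surjective p
  obtain ⟨q', rfl⟩ := finSumFinEquiv.surjective q
  rcases p' with i | a <;> rcases q' with i' | a'
  · simp only [finSumFinEquiv_apply_left, Fin.append_left] at hpq ⊢
    have h : (i : ℕ) < i' := by have := Fin.lt_def.1 hpq; simpa using this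
    exact hX (Fin.lt_def.2 h)
  · simp only [finSumFinEquiv_apply_left, finSumFinEquiv_apply_right, Fin.append_left,
      Fin.append_right]
    exact hXY i a'
  · exfalso
    simp only [finSumFinEquiv_apply_left, finSumFinEquiv_apply_right, Fin.lt_def,
      Fin.val_natAdd, Fin.val_castAdd] at hpq
    have := i'.isLt; omega
  · simp only [finSumFinEquiv_apply_right, Fin.append_right] at hpq ⊢
    apply hY
    simp only [Fin.lt_def, Fin.val_natAdd] at hpq
    exact Fin.lt_def.2 (by omega)

/-- **the even step**: `n` even; if `det G_n > 0` on all strictly increasing configurations of the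
ODD sizes `r` and `r + 2`, then `det G_n ≠ 0` on all strictly increasing configurations of size
`r + 1`. -/
theorem det_gram_ne_zero_of_between {n : ℕ} (hn : Even n) {r : ℕ}
    (hr : ∀ X : Fin r → ℝ, StrictMono X → 0 < (gram n X).det)
    (hr2 : ∀ W : Fin (r + 2) → ℝ, StrictMono W → 0 < (gram n W).det)
    (z : Fin (r + 1) → ℝ) (hz : StrictMono z) : (gram n z).det ≠ 0 := by
  -- split z = X ++ [y₁], and add a point y₂ = y₁ + 1
  set X : Fin r → ℝ := fun i => z (Fin.castAdd 1 i) with hXdef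
  set y₁ : ℝ := z (Fin.natAdd r 0) with hy₁
  set y₂ : ℝ := y₁ + 1 with hy₂
  have hX : StrictMono X := fun i j hij =>
    hz (Fin.lt_def.2 (by have := Fin.lt_def.1 hij; simpa using this))
  have hXy : ∀ i, X i < y₁ := fun i => hz (Fin.lt_def.2 (by simp))
  have hz_eq : z = Fin.append X ![y₁] := by
    funext p
    obtain ⟨p', rfl⟩ := finSumFinEquiv.surjective p
    rcases p' with i | a
    · rw [finSumFinEquiv_apply_left, Fin.append_left]
    · simp only [finSumFinEquiv_apply_right, Fin.append_right]
      have ha : a = 0 := Subsingleton.elim _ _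
      subst ha; rfl
  have hW : StrictMono (Fin.append X ![y₁, y₂]) := by
    refine strictMono_append hX ?_ ?_
    · intro a b hab
      fin_cases a <;> fin_cases b
      · exact absurd hab (lt_irrefl _)
      · show y₁ < y₂
        rw [hy₂]; linarith
      · exact absurd (Fin.lt_def.1 hab) (by norm_num)
      · exact absurd hab (lt_irrefl _)
    · intro i a
      fin_cases a
      · exact hXy i
      · show X i < y₂
        rw [hy₂]; linarith [hXy i]
  -- invertibility of A = G(X)
  have hApos := hr X hX
  letI : Invertible (gram n X) := Matrix.invertibleOfIsUnitDet _ (isUnit_iff_ne_zero.2 hApos.ne')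
  -- the two Schur factorisations
  have h1 := det_gram_append hn X ![y₁]
  have h2 := det_gram_append hn X ![y₁, y₂]
  set S₁ := gram n ![y₁] - (cross n X ![y₁])ᵀ * ⅟(gram n X) * cross n X ![y₁] with hS₁
  set S₂ := gram n ![y₁, y₂] - (cross n X ![y₁, y₂])ᵀ * ⅟(gram n X) * cross n X ![y₁, y₂] with hS₂
  have hS1det : S₁.det = S₁ 0 0 := Matrix.det_unique S₁
  have hS2det : S₂.det = S₂ 0 0 * S₂ 1 1 - S₂ 0 1 * S₂ 1 0 := Matrix.det_fin_two S₂
  have hsym : S₂ 1 0 = S₂ 0 1 := by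
    have := congrFun (congrFun (schur_transpose hn X ![y₁, y₂]) 0) 1
    rw [Matrix.transpose_apply] at this
    exact this
  have h00 : S₂ 0 0 = S₁ 0 0 := schur_two_zero_zero X y₁ y₂
  -- signs
  have hWpos := hr2 _ hW
  rw [h2, hS2det, hsym, h00] at hWpos
  have hprod : 0 < S₁ 0 0 * S₂ 1 1 := by
    have := (mul_pos_iff_of_pos_left hApos).1 hWpos
    nlinarith [sq_nonneg (S₂ 0 1)]
  have hS00 : S₁ 0 0 ≠ 0 := fun h => by rw [h, zero_mul] at hprod; exact lt_irrefl _ hprod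
  rw [hz_eq, h1, hS1det]
  exact mul_ne_zero hApos.ne' hS00

end Summit.Ventures.HSemireg.ApolarGram

namespace Summit.Ventures.HSemireg.ApolarGram

open Matrix Finset
open scoped BigOperators

/-! ### Assembly: THEOREM A(i) -/

/-- parity cells in determinant form. -/
theorem det_gram_ne_zero_parity {n ρ : ℕ} (hρ : 2 ≤ ρ) (hρn : ρ ≤ n + 1) (hpar : ρ % 2 ≠ n % 2)
    {x : Fin ρ → ℝ} (hx : StrictMono x) : (gram n x).det ≠ 0 := by
  intro h
  obtain ⟨c, hc, hGc⟩ := Matrix.exists_mulVec_eq_zero_iff.2 h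
  exact hc (gram_mulVec_eq_zero hρ hρn hpar hx hGc)

/-- **THEOREM A′ (odd ρ)**: `n` even, `ρ` odd, `3 ≤ ρ ≤ n + 1` ⇒ `det ((x_i − x_j)^n) > 0`. -/
theorem det_gram_pos_odd {n r : ℕ} (hn : Even n) (hr : Odd r) (h3 : 3 ≤ r) (hrn : r ≤ n + 1)
    {x : Fin r → ℝ} (hx : StrictMono x) : 0 < (gram n x).det := by
  obtain ⟨k, rfl⟩ : ∃ k, r = k + 1 := ⟨r - 1, by omega⟩
  have hk : Even k := by
    rcases hr with ⟨a, ha⟩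
    exact ⟨a, by omega⟩
  have hpar : (k + 1) % 2 ≠ n % 2 := by
    rcases hn with ⟨b, hb⟩; rcases hr with ⟨a, ha⟩; omega
  have hne : ∀ y : Fin (k + 1) → ℝ, StrictMono y → (gram n y).det ≠ 0 :=
    fun y hy => det_gram_ne_zero_parity (by omega) hrn hpar hy
  exact det_gram_pos_of_pos_at hne (cotConfig_strictMono k) hx
    (det_gram_cotConfig_pos k n hn hk (by omega) (hne _ (cotConfig_strictMono k)))

/-- **THEOREM A(i)**: `n` even, `2 ≤ ρ ≤ n + 1`, distinct increasing real atoms ⇒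
`det ((x_i − x_j)^n)_{i,j<ρ} ≠ 0`. -/
theorem det_gram_ne_zero_even {n ρ : ℕ} (hn : Even n) (hρ : 2 ≤ ρ) (hρn : ρ ≤ n + 1)
    {x : Fin ρ → ℝ} (hx : StrictMono x) : (gram n x).det ≠ 0 := by
  rcases Nat.even_or_odd ρ with he | ho
  · by_cases h2 : ρ = 2
    · subst h2
      have h01 : x 0 - x 1 ≠ 0 := sub_ne_zero.2 (hx.injective.ne (by decide))
      have h10 : x 1 - x 0 ≠ 0 := sub_ne_zero.2 (hx.injective.ne (by decide))
      rw [Matrix.det_fin_two]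
      simp only [gram, Matrix.of_apply, sub_self, zero_pow (by omega : n ≠ 0), zero_mul, zero_sub,
        neg_ne_zero]
      exact mul_ne_zero (pow_ne_zero _ h01) (pow_ne_zero _ h10)
    · obtain ⟨r, rfl⟩ : ∃ r, ρ = r + 1 := ⟨ρ - 1, by omega⟩
      have hr : Odd r := by
        rcases he with ⟨a, ha⟩
        exact ⟨a - 1, by omega⟩
      have hr2 : Odd (r + 2) := by
        rcases hr with ⟨a, ha⟩
        exact ⟨a + 1, by omega⟩
      have hrn2 : r + 2 ≤ n + 1 := by
        rcases hn with ⟨b, hb⟩; rcases he with ⟨a, ha⟩; omega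
      have h3 : 3 ≤ r := by rcases hr with ⟨a, ha⟩; omega
      exact det_gram_ne_zero_of_between hn
        (fun X hX => det_gram_pos_odd hn hr h3 (by omega) hX)
        (fun W hW => det_gram_pos_odd hn hr2 (by omega) hrn2 hW) x hx
  · exact det_gram_ne_zero_parity hρ hρn (by rcases hn with ⟨b, hb⟩; rcases ho with ⟨a, ha⟩; omega) hx

/-- **THEOREM A(i), rank form**: `n` even, `2 ≤ ρ ≤ n + 1` ⇒ `rank ((x_i − x_j)^n) = ρ`. -/
theorem rank_gram_even {n ρ : ℕ} (hn : Even n) (hρ : 2 ≤ ρ) (hρn : ρ ≤ n + 1)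
    {x : Fin ρ → ℝ} (hx : StrictMono x) : (gram n x).rank = ρ := by
  have hU : IsUnit (gram n x) :=
    (Matrix.isUnit_iff_isUnit_det _).2 (isUnit_iff_ne_zero.2 (det_gram_ne_zero_even hn hρ hρn hx))
  rw [Matrix.rank_of_isUnit _ hU, Fintype.card_fin]

/-- **One-sided rank-law input, `n` even**: for exponential data with `2 ≤ ρ ≤ n + 1` distinct
increasing nodes and non-zero weights, `rank (H_n(q) Ω_n H_n(q)) = ρ`. -/
theorem rank_hsq_omega_hsq_even {n ρ : ℕ} (hn : Even n) (hρ : 2 ≤ ρ) (hρn : ρ ≤ n + 1)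
    {c x : Fin ρ → ℝ} (hc : ∀ i, c i ≠ 0) (hx : StrictMono x) :
    (hsq n (expMoments c x) * omega n * hsq n (expMoments c x)).rank = ρ := by
  rw [rank_hsq_omega_hsq hρn hc hx.injective, rank_gram_even hn hρ hρn hx]


/-! ### The Hankel rank of exponential data (the `ρ` of the one-sided rank law) -/

/-- the node matrix is the weighted node matrix with unit weights. -/
theorem nodeMat_eq_wNodeMat_one (n : ℕ) {ρ : ℕ} (x : Fin ρ → ℝ) :
    nodeMat n x = wNodeMat n (fun _ => (1 : ℝ)) x := by
  ext i l; simp [nodeMat, wNodeMat]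

/-- **`rank H_n(q) = ρ`** for exponential data with `ρ ≤ n + 1` distinct nodes and non-zero
weights: the Hankel rank IS the number of atoms. -/
theorem rank_hsq_expMoments {n ρ : ℕ} (hρn : ρ ≤ n + 1) {c x : Fin ρ → ℝ} (hc : ∀ i, c i ≠ 0)
    (hx : Function.Injective x) : (hsq n (expMoments c x)).rank = ρ := by
  have hinj := wNodeMat_transpose_mulVec_injective (n := n) hρn hc hx
  have hsurj : LinearMap.range (nodeMat n x).mulVecLin = ⊤ := by
    rw [nodeMat_eq_wNodeMat_one]
    exact range_wNodeMat_mulVecLin_eq_top hρn (fun _ => one_ne_zero) hx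
  rw [hsq_expMoments_eq, rank_eq_finrank_range, Matrix.mulVecLin_mul,
    LinearMap.range_comp_of_range_eq_top _ hsurj, LinearMap.finrank_range_of_inj hinj,
    Module.finrank_fin_fun]

/-- **THEOREM A for the one-sided rank law, `n` even, in Hankel terms**: for exponential data with
`2 ≤ ρ ≤ n + 1` distinct increasing nodes and non-zero weights,
`rank H_n(q) = ρ` and `rank (H_n(q) Ω_n H_n(q)) = ρ`. -/
theorem hankel_dictionary_even {n ρ : ℕ} (hn : Even n) (hρ : 2 ≤ ρ) (hρn : ρ ≤ n + 1)
    {c x : Fin ρ → ℝ} (hc : ∀ i, c i ≠ 0) (hx : StrictMono x) :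
    (hsq n (expMoments c x)).rank = ρ ∧
      (hsq n (expMoments c x) * omega n * hsq n (expMoments c x)).rank = ρ :=
  ⟨rank_hsq_expMoments hρn hc hx.injective, rank_hsq_omega_hsq_even hn hρ hρn hc hx⟩

/-- **… and `n` odd**: `rank H_n(q) = ρ + 1` and `rank (H_n Ω_n H_n) = ρ` for `ρ + 1` odd nodes
(`3 ≤ ρ + 1 ≤ n + 1`); `= ρ` and `= ρ` for `ρ` even nodes (`2 ≤ ρ ≤ n + 1`). -/
theorem hankel_dictionary_odd_odd {n ρ : ℕ} (hn : Odd n) (hρodd : Odd (ρ + 1)) (hρ : 3 ≤ ρ + 1)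
    (hρn : ρ + 1 ≤ n + 1) {c x : Fin (ρ + 1) → ℝ} (hc : ∀ i, c i ≠ 0) (hx : StrictMono x) :
    (hsq n (expMoments c x)).rank = ρ + 1 ∧
      (hsq n (expMoments c x) * omega n * hsq n (expMoments c x)).rank = ρ :=
  ⟨rank_hsq_expMoments hρn hc hx.injective, rank_hsq_omega_hsq_odd_odd hn hρodd hρ hρn hc hx⟩

/-- **… parity cells**: `ρ ≢ n (mod 2)`, `2 ≤ ρ ≤ n + 1`: `rank H_n(q) = ρ` and
`rank (H_n Ω_n H_n) = ρ`. -/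
theorem hankel_dictionary_odd_even {n ρ : ℕ} (hρ : 2 ≤ ρ) (hρn : ρ ≤ n + 1) (hpar : ρ % 2 ≠ n % 2)
    {c x : Fin ρ → ℝ} (hc : ∀ i, c i ≠ 0) (hx : StrictMono x) :
    (hsq n (expMoments c x)).rank = ρ ∧
      (hsq n (expMoments c x) * omega n * hsq n (expMoments c x)).rank = ρ :=
  ⟨rank_hsq_expMoments hρn hc hx.injective, rank_hsq_omega_hsq_parity hρ hρn hpar hc hx⟩

end Summit.Ventures.HSemireg.ApolarGram
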